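import Mathlib

/-!
# Solo-blind seat, s19 anchor: two-subgroup TPP triples in every codimension (Theorem 14) — arithmetic core

Companion to `paper/LieExponent.md` §3.28 (solo-blind seat `solo-MatrixMultiplication-blind`, s19, 2026-08-23).

SETTING (pen side).  `G` a real Lie group, `d = dim G`, `ι = ind 𝔤`; `(M₁; H₂, H₃)` a TPP triple with two
connected Lie-subgroup members `H₂, H₃` and an arbitrary connected `C^∞` third member `M₁`, dimensions
`d₁, d₂, d₃`, `Σ = d₁ + d₂ + d₃ > d`, `m = d − d₂ − d₃` the codimension of `𝔥₂ ⊕ 𝔥₃`, deficit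
`δ = 3d/2 − Σ`.  THEOREM 14 of the companion note:
* (i) pair bound `δ ≥ m/2 + 1` (Lemma 2.1 for the two pairs containing `M₁`);
* (ii) in the characteristic tower of Theorem 10 (§3.23) every level is again a two-subgroup triple whose
  codimension drops by at least one per level (`m^{(ℓ+1)} ≤ m^{(ℓ)} − 1`: the subgroup slices lose at most
  `ρ_ℓ/2` each by isotropy while the group loses `1 + ρ_ℓ`), so the depth is `≤ m`, the annihilator motion
  at level `ℓ` is `R_ℓ ≤ m − 1 − ℓ` (Lemma 3.23(i); the subgroup members are motionless), and the
  motion–deficit inequality (MD) `δ + Σ_{ℓ<t} R_ℓ ≥ (ι + t + 1)/2` yields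
  `δ ≥ (ι + 1 − (m − 1)²)/2 + (t − m + 1)²/2 ≥ (ι + 1 − (m − 1)²)/2`;
* (iii) (i) + (ii) ⟹ `(4δ − 5)² + 7 ≥ 4ι`, i.e. `δ ≥ (5 + √(4ι − 7))/4`: the deficit of EVERY TPP triple with
  two connected Lie-subgroup members tends to infinity with the index (GL_n(ℝ): `Σ ≤ 3n²/2 − (5 + √(4n−7))/4`).

Kernel-checked here (the geometric inputs — (MD), Lemma 3.23(i), the isotropy count, Lemma 2.1 — enter as
hypotheses; what is certified is the bookkeeping):
* `soloLie_twoSubgroup_pair` — (i).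
* `soloLie_twoSubgroup_codim_step` — the one-level codimension drop.
* `soloLie_twoSubgroup_motion_sum` — `Σ_{ℓ<t} (m − 1 − ℓ) = t(m − 1) − t(t − 1)/2`.
* `soloLie_twoSubgroup_quadratic`, `soloLie_twoSubgroup_quadratic'` — (ii) from (MD).
* `soloLie_twoSubgroup_small_cases` — `m = 1, 2, 3`: `δ ≥ ι/2 + 1`, `ι/2`, `(ι − 3)/2`
  (Theorem 9, Proposition 9.3, new).
* `soloLie_twoSubgroup_unbounded`, `soloLie_twoSubgroup_sqrt` — (iii).
-/

set_option linter.dupNamespace false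

namespace Summit.MatrixMultiplication.MatrixMultiplication.Theorems

open Finset

/-- THEOREM 14(i), PAIR BOUND.  With `m = d − d₂ − d₃`, `δ = 3d/2 − Σ` and the two pair bounds
`d₁ + d₂ ≤ d − 1`, `d₁ + d₃ ≤ d − 1` (Lemma 2.1): `δ ≥ m/2 + 1`. -/
theorem soloLie_twoSubgroup_pair (d d₁ d₂ d₃ m δ : ℝ) (hm : m = d - d₂ - d₃)
    (hδ : δ = 3 * d / 2 - (d₁ + d₂ + d₃)) (h12 : d₁ + d₂ ≤ d - 1) (h13 : d₁ + d₃ ≤ d - 1) :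
    m / 2 + 1 ≤ δ := by
  subst hm hδ
  linarith

/-- THEOREM 14(ii), THE CODIMENSION DROPS DOWN THE TOWER.  At a level with group dimension `a`,
subgroup-slice dimensions `k₂, k₃` (codimension `m = a − k₂ − k₃`) and annihilator of rank `ρ` on its
kernel, the next characteristic group has dimension `a' = a − 1 − ρ` (Lemma 3.20) and the subgroup
slices keep `k_j' ≥ k_j − ρ/2` (isotropy of subalgebras of `ker λ`); hence `m' ≤ m − 1`. -/
theorem soloLie_twoSubgroup_codim_step (a a' ρ k₂ k₃ k₂' k₃' : ℝ)
    (ha : a' = a - 1 - ρ) (h₂ : k₂ - ρ / 2 ≤ k₂') (h₃ : k₃ - ρ / 2 ≤ k₃') :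
    a' - k₂' - k₃' ≤ (a - k₂ - k₃) - 1 := by
  subst ha
  linarith

/-- The motion budget of a tower of depth `t` over a pair of codimension `m`:
`Σ_{ℓ<t} (m − 1 − ℓ) = t(m − 1) − t(t − 1)/2`. -/
theorem soloLie_twoSubgroup_motion_sum (m t : ℕ) :
    (∑ ℓ ∈ range t, ((m : ℝ) - 1 - ℓ)) = t * ((m : ℝ) - 1) - t * ((t : ℝ) - 1) / 2 := by
  induction t with
  | zero => simp
  | succ n ih =>
    rw [sum_range_succ, ih]
    push_cast
    ring

/-- THEOREM 14(ii), QUADRATIC FORM.  If the motion–deficit inequality (MD)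
`(ι + t + 1)/2 ≤ δ + Σ_{ℓ<t} R ℓ` holds and the motion is bounded by the shrinking codimension,
`R ℓ ≤ m − 1 − ℓ` for `ℓ < t`, then `δ ≥ (ι + 1 − (m − 1)²)/2 + (t − m + 1)²/2`. -/
theorem soloLie_twoSubgroup_quadratic (ι δ : ℝ) (m t : ℕ) (R : ℕ → ℝ)
    (hMD : (ι + t + 1) / 2 ≤ δ + ∑ ℓ ∈ range t, R ℓ)
    (hR : ∀ ℓ, ℓ < t → R ℓ ≤ (m : ℝ) - 1 - ℓ) :
    (ι + 1 - ((m : ℝ) - 1) ^ 2) / 2 + ((t : ℝ) - m + 1) ^ 2 / 2 ≤ δ := by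
  have hsum : (∑ ℓ ∈ range t, R ℓ) ≤ ∑ ℓ ∈ range t, ((m : ℝ) - 1 - ℓ) :=
    sum_le_sum (fun ℓ hℓ => hR ℓ (mem_range.mp hℓ))
  rw [soloLie_twoSubgroup_motion_sum] at hsum
  have key : (ι + t + 1) / 2 - ((t : ℝ) * ((m : ℝ) - 1) - t * ((t : ℝ) - 1) / 2)
      = (ι + 1 - ((m : ℝ) - 1) ^ 2) / 2 + ((t : ℝ) - m + 1) ^ 2 / 2 := by ring
  linarith

/-- THEOREM 14(ii), the form used downstream: `δ ≥ (ι + 1 − (m − 1)²)/2`. -/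
theorem soloLie_twoSubgroup_quadratic' (ι δ : ℝ) (m t : ℕ) (R : ℕ → ℝ)
    (hMD : (ι + t + 1) / 2 ≤ δ + ∑ ℓ ∈ range t, R ℓ)
    (hR : ∀ ℓ, ℓ < t → R ℓ ≤ (m : ℝ) - 1 - ℓ) :
    (ι + 1 - ((m : ℝ) - 1) ^ 2) / 2 ≤ δ := by
  have h := soloLie_twoSubgroup_quadratic ι δ m t R hMD hR
  nlinarith [sq_nonneg ((t : ℝ) - m + 1)]

/-- THEOREM 14(ii), SMALL CODIMENSIONS.  `m = 1`: with depth `t ≥ 1`, `δ ≥ ι/2 + 1` (Theorem 9's value,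
`Σ ≤ (3d − ι)/2 − 1 = F`); `m = 2`: `δ ≥ ι/2` (Proposition 9.3, `Σ ≤` the Kirillov threshold);
`m = 3`: `δ ≥ (ι − 3)/2`. -/
theorem soloLie_twoSubgroup_small_cases (ι δ : ℝ) (t : ℕ) (R : ℕ → ℝ)
    (hMD : (ι + t + 1) / 2 ≤ δ + ∑ ℓ ∈ range t, R ℓ) :
    ((1 ≤ t) → (∀ ℓ, ℓ < t → R ℓ ≤ ((1 : ℕ) : ℝ) - 1 - ℓ) → ι / 2 + 1 ≤ δ) ∧
    ((∀ ℓ, ℓ < t → R ℓ ≤ ((2 : ℕ) : ℝ) - 1 - ℓ) → ι / 2 ≤ δ) ∧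
    ((∀ ℓ, ℓ < t → R ℓ ≤ ((3 : ℕ) : ℝ) - 1 - ℓ) → (ι - 3) / 2 ≤ δ) := by
  refine ⟨fun ht hR => ?_, fun hR => ?_, fun hR => ?_⟩
  · have h := soloLie_twoSubgroup_quadratic ι δ 1 t R hMD hR
    have ht' : (1 : ℝ) ≤ t := by exact_mod_cast ht
    push_cast at h
    nlinarith [h, ht']
  · have h := soloLie_twoSubgroup_quadratic' ι δ 2 t R hMD hR
    push_cast at h
    linarith
  · have h := soloLie_twoSubgroup_quadratic' ι δ 3 t R hMD hR
    push_cast at h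
    linarith

/-- THEOREM 14(iii), UNBOUNDED DEFICIT (square form).  From the pair bound `δ ≥ m/2 + 1` and the
quadratic bound `δ ≥ (ι + 1 − (m − 1)²)/2` with `m ≥ 1`: `4ι ≤ (4δ − 5)² + 7`. -/
theorem soloLie_twoSubgroup_unbounded (ι δ : ℝ) (m : ℕ) (hm : 1 ≤ m)
    (hpair : (m : ℝ) / 2 + 1 ≤ δ) (hquad : (ι + 1 - ((m : ℝ) - 1) ^ 2) / 2 ≤ δ) :
    4 * ι ≤ (4 * δ - 5) ^ 2 + 7 := by
  have hm' : (1 : ℝ) ≤ m := by exact_mod_cast hm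
  have hx0 : (0 : ℝ) ≤ (m : ℝ) - 1 := by linarith
  have hx1 : (m : ℝ) - 1 ≤ 2 * δ - 3 := by linarith
  have hmul : ((m : ℝ) - 1) * ((m : ℝ) - 1) ≤ (2 * δ - 3) * (2 * δ - 3) :=
    mul_le_mul hx1 hx1 hx0 (by linarith)
  have hsq : ((m : ℝ) - 1) ^ 2 ≤ (2 * δ - 3) ^ 2 := by nlinarith [hmul]
  nlinarith [hsq, hquad]

/-- THEOREM 14(iii), square-root form: `δ ≥ (5 + √(4ι − 7))/4` (for `4ι ≥ 7`; `4δ ≥ 5` follows from the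
pair bound). -/
theorem soloLie_twoSubgroup_sqrt (ι δ : ℝ) (hδ : 5 ≤ 4 * δ)
    (h : 4 * ι ≤ (4 * δ - 5) ^ 2 + 7) :
    (5 + Real.sqrt (4 * ι - 7)) / 4 ≤ δ := by
  have h1 : Real.sqrt (4 * ι - 7) ≤ Real.sqrt ((4 * δ - 5) ^ 2) :=
    Real.sqrt_le_sqrt (by linarith)
  rw [Real.sqrt_sq (by linarith)] at h1
  linarith

/-- GL_n(ℝ) reading (`ι = n`, `d = n²`): every TPP triple of `GL_n(ℝ)` with two connected Lie-subgroup
members and `Σ > n²` has `Σ ≤ 3n²/2 − (5 + √(4n − 7))/4`. -/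
theorem soloLie_twoSubgroup_GL (n Sig δ : ℝ) (hδ : δ = 3 * n ^ 2 / 2 - Sig) (hδ5 : 5 ≤ 4 * δ)
    (h : 4 * n ≤ (4 * δ - 5) ^ 2 + 7) :
    Sig ≤ 3 * n ^ 2 / 2 - (5 + Real.sqrt (4 * n - 7)) / 4 := by
  have := soloLie_twoSubgroup_sqrt n δ hδ5 h
  linarith

end Summit.MatrixMultiplication.MatrixMultiplication.Theorems
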